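import Summits.RiemannHypothesis.RiemannHypothesis.Theorems.SuzukiFlowPairingWeilSide

/-!
# Operator side of `FlowPairing`: the exponential (polar / Gauss) pieces through the window (column DBR; RH-FREE)

RH-FREE throughout; nothing here bears on the truth of RH.  In the explicit real form of the flow kernel
(`Theorems.SuzukiFlowKernelReal.flowKernel_eq`) every non-atomic piece of `J_θ = k ∗ K_θ` has the shape
`J_a(w) = ∫₀^∞ e^{av} K_θ(w − v) dv` (`a = −½, ½` polar; `a = −2k−½` in the Gauss–digamma series).  For
`G = 𝖪_θ[t] f` (`winOp`), `f ∈ L¹(−t,t)`, this file carries such a piece through the two window integrations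
of `⟨𝖪_θ[t]f, 𝒥_θ[t]f⟩` (two Fubini swaps, justified by causality — `K_θ(x+y−v) = 0` for `v ≥ x+y` — and
the bounds of `Theorems.SuzukiFlowPairingWeilSide`):

* `winOp_expPiece` — `∫_{(−t,t)} J_a(x+y) f(y) dy = ∫₀^∞ e^{av} G(x − v) dv`;
* `integral_winOp_mul_expPiece` — `∫_{(−t,t)} G(x)·(∫₀^∞ e^{av} G(x − v) dv) dx = ∫₀^∞ e^{av} Φ(v) dv`,
  `Φ(v) = ∫_{(−t,t)} G(x)G(x − v) dx` (`= (g_θ ⋆ g̃_θ)(v)` for `v ≥ 0` by the pairing lemma of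
  `Theorems.SuzukiFlowPairingCausality`);
* `integral_winOp_mul_winOp_expPiece` — the two combined:
  `∫_{(−t,t)} G(x)·(𝖩_a f)(x) dx = ∫₀^∞ e^{av} Φ(v) dv`, `(𝖩_a f)(x) = ∫_{(−t,t)} J_a(x+y) f(y) dy`.

References: [Su20] M. Suzuki, ASPM 84 (2020); E. Bombieri, Rend. Lincei (9) 11 (2000), §2.
-/

noncomputable section

-- D-0017: `Summit.<S>.<S>.…` is the designed namespace of a single-problem summit.
set_option linter.dupNamespace false

open Complex MeasureTheory Set Filter Topology
open scoped Real

namespace Summit.RiemannHypothesis.RiemannHypothesis.Theorems.SuzukiThetaFlow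

open Literature.NumberTheory.LFunctions
open Summit.RiemannHypothesis.RiemannHypothesis.Theorems.SuzukiKernelSemigroup

variable {θ t : ℝ} {f : ℝ → ℝ}

/-- RH-FREE.  **Inner swap**: for `θ > 1`, `f ∈ L¹(−t,t)`, real `a`, `x`:
`∫_{(−t,t)} (∫₀^∞ e^{av} K_θ(x+y−v) dv) f(y) dy = ∫₀^∞ e^{av} (𝖪_θ[t]f)(x − v) dv` (Fubini on
`(−t,t) × (0,∞)`; the integrand vanishes for `v ≥ x + t` and is bounded by `e^{|a||x+t|}·sup|K_θ|·|f(y)|`). -/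
theorem winOp_expPiece (hθ : 1 < θ) (hf : IntegrableOn f (Ioo (-t) t)) (a x : ℝ) :
    ∫ y in Ioo (-t) t, (∫ v in Ioi (0 : ℝ), Real.exp (a * v) * limKernel θ (x + y - v)) * f y =
      ∫ v in Ioi (0 : ℝ), Real.exp (a * v) * winOp (limKernel θ) t f (x - v) := by
  obtain ⟨MK, hMK0, hMK⟩ := exists_abs_limKernel_le_of_le hθ (x + t)
  set μ : Measure ℝ := volume.restrict (Ioo (-t) t) with hμ
  set ν : Measure ℝ := volume.restrict (Ioi (0 : ℝ)) with hν
  set F : ℝ → ℝ → ℝ := fun y v => Real.exp (a * v) * limKernel θ (x + y - v) * f y with hF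
  have hFm : AEStronglyMeasurable (Function.uncurry F) (μ.prod ν) := by
    have hK : Continuous fun p : ℝ × ℝ => Real.exp (a * p.2) * limKernel θ (x + p.1 - p.2) :=
      (Real.continuous_exp.comp (by fun_prop)).mul ((Suzuki2020_thm12_continuous hθ).comp (by fun_prop))
    exact hK.aestronglyMeasurable.mul hf.aestronglyMeasurable.comp_fst
  have hae : ∀ᵐ p : ℝ × ℝ ∂(μ.prod ν), p ∈ Ioo (-t) t ×ˢ Ioi (0 : ℝ) := by
    rw [hμ, hν, Measure.prod_restrict]
    exact ae_restrict_mem (measurableSet_Ioo.prod measurableSet_Ioi)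
  -- majorant `|f(y)| · (B · 𝟙_{v ≤ |x+t|})`, `B = e^{|a||x+t|} sup|K|`
  set B : ℝ := Real.exp (|a| * |x + t|) * MK with hB
  have hind : Integrable (fun v : ℝ => (Iic (|x + t|)).indicator (fun _ => B) v) ν := by
    rw [hν]
    refine (integrable_indicator_iff measurableSet_Iic).2 ?_
    rw [IntegrableOn, Measure.restrict_restrict measurableSet_Iic,
      show Iic (|x + t|) ∩ Ioi (0 : ℝ) = Ioc 0 (|x + t|) by ext v; simp [and_comm]]
    exact integrableOn_const measure_Ioc_lt_top.ne
  have hFi : Integrable (Function.uncurry F) (μ.prod ν) := by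
    have hmaj : Integrable (fun p : ℝ × ℝ => |f p.1| * (Iic (|x + t|)).indicator (fun _ => B) p.2) (μ.prod ν) :=
      hf.abs.mul_prod hind
    refine hmaj.mono' hFm (hae.mono fun p hp => ?_)
    obtain ⟨y, v⟩ := p
    obtain ⟨⟨hy1, hy2⟩, hv⟩ := hp
    simp only [Function.uncurry_apply_pair, hF, Real.norm_eq_abs]
    rcases le_or_gt v (|x + t|) with hv' | hv'
    · rw [Set.indicator_of_mem (mem_Iic.2 hv'), abs_mul, abs_mul, Real.abs_exp]
      have h1 : Real.exp (a * v) ≤ Real.exp (|a| * |x + t|) := Real.exp_le_exp.2 (by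
        calc a * v ≤ |a * v| := le_abs_self _
          _ = |a| * v := by rw [abs_mul, abs_of_pos (mem_Ioi.1 hv)]
          _ ≤ |a| * |x + t| := mul_le_mul_of_nonneg_left hv' (abs_nonneg a))
      have h2 : |limKernel θ (x + y - v)| ≤ MK := hMK _ (by linarith [mem_Ioi.1 hv])
      calc Real.exp (a * v) * |limKernel θ (x + y - v)| * |f y| ≤ (Real.exp (|a| * |x + t|) * MK) * |f y| :=
            mul_le_mul_of_nonneg_right (mul_le_mul h1 h2 (abs_nonneg _) (Real.exp_pos _).le) (abs_nonneg _)
        _ = |f y| * B := by rw [hB]; ring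
    · have hneg : x + y - v ≤ 0 := by linarith [le_abs_self (x + t)]
      rw [limKernel_eq_zero_of_nonpos hθ hneg, mul_zero, zero_mul, abs_zero]
      exact mul_nonneg (abs_nonneg _) (Set.indicator_nonneg (fun _ _ => by positivity) _)
  have hswap := integral_integral_swap hFi
  simp only [hF] at hswap
  -- left side: pull `f y` inside the `v`-integral; right side: unfold the shifted output
  have hl : ∫ y in Ioo (-t) t, (∫ v in Ioi (0 : ℝ), Real.exp (a * v) * limKernel θ (x + y - v)) * f y =
      ∫ y in Ioo (-t) t, ∫ v in Ioi (0 : ℝ), Real.exp (a * v) * limKernel θ (x + y - v) * f y := by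
    refine setIntegral_congr_fun measurableSet_Ioo fun y _ => ?_
    rw [← integral_mul_const]
  rw [hl, hswap]
  refine setIntegral_congr_fun measurableSet_Ioi fun v _ => ?_
  rw [winOp_sub_eq, ← integral_const_mul]
  refine setIntegral_congr_fun measurableSet_Ioo fun y _ => ?_
  ring

/-- RH-FREE.  **Outer swap**: for `θ > 1`, `f ∈ L¹(−t,t)`, real `a`:
`∫_{(−t,t)} G(x)·(∫₀^∞ e^{av} G(x − v) dv) dx = ∫₀^∞ e^{av} (∫_{(−t,t)} G(x)G(x − v) dx) dv`, `G = 𝖪_θ[t]f`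
(Fubini on `(−t,t) × (0,∞)`; `G(x − v) = 0` for `v ≥ x + t`, `|G| ≤ M` on `(−∞,t]`). -/
theorem integral_winOp_mul_expPiece (hθ : 1 < θ) (hf : IntegrableOn f (Ioo (-t) t)) (a : ℝ) :
    ∫ x in Ioo (-t) t, winOp (limKernel θ) t f x *
        ∫ v in Ioi (0 : ℝ), Real.exp (a * v) * winOp (limKernel θ) t f (x - v) =
      ∫ v in Ioi (0 : ℝ), Real.exp (a * v) *
        ∫ x in Ioo (-t) t, winOp (limKernel θ) t f x * winOp (limKernel θ) t f (x - v) := by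
  obtain ⟨M, hM0, hM⟩ := exists_abs_winOp_le hθ hf
  have hGc := continuous_winOp hθ hf
  set μ : Measure ℝ := volume.restrict (Ioo (-t) t) with hμ
  set ν : Measure ℝ := volume.restrict (Ioi (0 : ℝ)) with hν
  set F : ℝ → ℝ → ℝ := fun x v => winOp (limKernel θ) t f x * (Real.exp (a * v) * winOp (limKernel θ) t f (x - v))
    with hF
  have hFm : AEStronglyMeasurable (Function.uncurry F) (μ.prod ν) := by
    have hK : Continuous fun p : ℝ × ℝ => winOp (limKernel θ) t f p.1 *
        (Real.exp (a * p.2) * winOp (limKernel θ) t f (p.1 - p.2)) :=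
      (hGc.comp continuous_fst).mul ((Real.continuous_exp.comp (by fun_prop)).mul (hGc.comp (by fun_prop)))
    exact hK.aestronglyMeasurable
  have hae : ∀ᵐ p : ℝ × ℝ ∂(μ.prod ν), p ∈ Ioo (-t) t ×ˢ Ioi (0 : ℝ) := by
    rw [hμ, hν, Measure.prod_restrict]
    exact ae_restrict_mem (measurableSet_Ioo.prod measurableSet_Ioi)
  set B : ℝ := Real.exp (|a| * (2 * |t|)) * M with hB
  have hind : Integrable (fun v : ℝ => (Iic (2 * |t|)).indicator (fun _ => B) v) ν := by
    rw [hν]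
    refine (integrable_indicator_iff measurableSet_Iic).2 ?_
    rw [IntegrableOn, Measure.restrict_restrict measurableSet_Iic,
      show Iic (2 * |t|) ∩ Ioi (0 : ℝ) = Ioc 0 (2 * |t|) by ext v; simp [and_comm]]
    exact integrableOn_const measure_Ioc_lt_top.ne
  have hFi : Integrable (Function.uncurry F) (μ.prod ν) := by
    have hmaj : Integrable (fun p : ℝ × ℝ => M * (Iic (2 * |t|)).indicator (fun _ => B) p.2) (μ.prod ν) := by
      have h1 : Integrable (fun _ : ℝ => M) μ := by
        rw [hμ]; exact integrableOn_const measure_Ioo_lt_top.ne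
      exact h1.mul_prod hind
    refine hmaj.mono' hFm (hae.mono fun p hp => ?_)
    obtain ⟨x, v⟩ := p
    obtain ⟨⟨hx1, hx2⟩, hv⟩ := hp
    have hv0 : 0 < v := mem_Ioi.1 hv
    simp only [Function.uncurry_apply_pair, hF, Real.norm_eq_abs]
    rcases le_or_gt v (2 * |t|) with hv' | hv'
    · rw [Set.indicator_of_mem (mem_Iic.2 hv'), abs_mul, abs_mul, Real.abs_exp]
      have h1 : Real.exp (a * v) ≤ Real.exp (|a| * (2 * |t|)) := Real.exp_le_exp.2 (by
        calc a * v ≤ |a * v| := le_abs_self _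
          _ = |a| * v := by rw [abs_mul, abs_of_pos hv0]
          _ ≤ |a| * (2 * |t|) := mul_le_mul_of_nonneg_left hv' (abs_nonneg a))
      have h2 : |winOp (limKernel θ) t f (x - v)| ≤ M := hM _ (by linarith)
      have h3 : |winOp (limKernel θ) t f x| ≤ M := hM _ hx2.le
      calc |winOp (limKernel θ) t f x| * (Real.exp (a * v) * |winOp (limKernel θ) t f (x - v)|)
          ≤ M * (Real.exp (|a| * (2 * |t|)) * M) :=
            mul_le_mul h3 (mul_le_mul h1 h2 (abs_nonneg _) (Real.exp_pos _).le) (by positivity) hM0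
        _ = M * B := by rw [hB]
    · have hneg : x - v ≤ -t := by linarith [le_abs_self t]
      rw [winOp_limKernel_eq_zero_of_le hθ hneg f, mul_zero, mul_zero, abs_zero]
      exact mul_nonneg hM0 (Set.indicator_nonneg (fun _ _ => by positivity) _)
  have hswap := integral_integral_swap hFi
  simp only [hF] at hswap
  have hl : ∫ x in Ioo (-t) t, winOp (limKernel θ) t f x *
      ∫ v in Ioi (0 : ℝ), Real.exp (a * v) * winOp (limKernel θ) t f (x - v) =
      ∫ x in Ioo (-t) t, ∫ v in Ioi (0 : ℝ), winOp (limKernel θ) t f x *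
        (Real.exp (a * v) * winOp (limKernel θ) t f (x - v)) := by
    refine setIntegral_congr_fun measurableSet_Ioo fun x _ => ?_
    rw [← integral_const_mul]
  rw [hl, hswap]
  refine setIntegral_congr_fun measurableSet_Ioi fun v _ => ?_
  rw [← integral_const_mul]
  refine setIntegral_congr_fun measurableSet_Ioo fun x _ => ?_
  ring

/-- **RH-FREE · an exponential piece of the flow kernel through both window integrations**: for `θ > 1`,
`f ∈ L¹(−t,t)`, real `a`, with `G = 𝖪_θ[t]f` and `J_a(w) = ∫₀^∞ e^{av}K_θ(w−v)dv`,
`∫_{(−t,t)} G(x)·(∫_{(−t,t)} J_a(x+y) f(y) dy) dx = ∫₀^∞ e^{av} (∫_{(−t,t)} G(x)G(x−v) dx) dv`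
— and for `v ≥ 0` the inner pairing is `(g_θ ⋆ g̃_θ)(v)` (`weilConv_winOut_weilReflect_of_nonneg`).
Nothing here bears on RH. -/
theorem integral_winOp_mul_winOp_expPiece (hθ : 1 < θ) (hf : IntegrableOn f (Ioo (-t) t)) (a : ℝ) :
    ∫ x in Ioo (-t) t, winOp (limKernel θ) t f x *
        ∫ y in Ioo (-t) t, (∫ v in Ioi (0 : ℝ), Real.exp (a * v) * limKernel θ (x + y - v)) * f y =
      ∫ v in Ioi (0 : ℝ), Real.exp (a * v) *
        ∫ x in Ioo (-t) t, winOp (limKernel θ) t f x * winOp (limKernel θ) t f (x - v) := by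
  rw [← integral_winOp_mul_expPiece hθ hf a]
  refine setIntegral_congr_fun measurableSet_Ioo fun x _ => ?_
  rw [winOp_expPiece hθ hf a x]

end Summit.RiemannHypothesis.RiemannHypothesis.Theorems.SuzukiThetaFlow

end
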